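import Literature.NumberTheory.LFunctions.YoshidaWindowGramEnclosure
import HarnessLib

/-!
# Kernel enclosures of Yoshida's matrix coefficients — II: records, constants, special values at a mode

Source: H. Yoshida, Adv. Stud. Pure Math. **21** (1992) 281–325, §5 (5.15)/(5.16) p. 301
[Yoshida1992HermitianForms].  The index-independent constants of `gramCoeff a n m` — `π`, `a`, `1/a`, `1/π`,
`log π`, the polar constant `(4/a)(e^{a/2} − e^{−a/2})²`, the table `e_k = e^{−2a l_k}` (`k < K`) with the certified
geometric tail `e^{−a(4K+1)}/(1 − e^{−4a})`, and per listed prime power `q = p^e` the length `ℓ_q = e log p`, the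
weight `Λ(q)q^{−1/2} = log p·e^{−ℓ_q/2}` and the diagonal factor `2 − ℓ_q/a` — as a record `Encl.Consts` of
intervals at scale `S`, its validity predicate `Encl.ConstsValid`, the kernel function `Encl.consts` computing it from
enclosures `P ∋ π`, `A ∋ a` on the tree's multi-precision engine (`MI.exp`, `MI.logNat2`, `MI.logPos`, `MI.divPos`),
and the inclusion theorem `Encl.constsValid_of_consts`; the per-mode record type `Encl.IdxRec` with its
validity predicates (`OffValid`, `DiagValid`, `IdxValid`) and the parity transport `OffValid.flip` (mode `m ↦ −m`);
and, for a mode `n ≥ 0`, the kernel function `Encl.idxRec` computing intervals for `ω_n = πn/a`, `1/(1 + 4ω_n²)`,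
`Re ψ(¼ + iω_n/2)`, `Im ψ(¼ + iω_n/2)` (`MC.digammaBox`), `Re ψ′(¼ + iω_n/2)` (`MC.trigammaBox`), the exponential sums
`archExpSumDiag a n`, `archExpSumSin a n` (truncated sums `Encl.dsum`/`Encl.ssum` widened by the certified tail) and
the phases `e^{iω_n ℓ_q}` (`MC.expI`), with the inclusion theorem `Encl.idxValid_of_idxRec`.
Everything is proved; no named facts.
-/

open Real Complex Finset
open scoped BigOperators

namespace Literature.NumberTheory.LFunctions.Yoshida1992

open Literature.Analysis.SpecialFunctions Literature.Analysis.ValidatedNumerics.NumericsMP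

namespace Encl

variable {a : ℝ}

/-! ## 4. Option-valued list maps (structural; kernel-friendly) -/

/-- `omap f xs`: apply a partial function to every entry, failing if one fails. [cite: Moore1966, Ch. 3 (interval arithmetic: inclusion property)] -/
def omap {α β : Type} (f : α → Option β) : List α → Option (List β)
  | [] => some []
  | x :: xs =>
    match f x, omap f xs with
    | some y, some ys => some (y :: ys)
    | _, _ => none

/-- Specification of `omap`: lengths agree and every entry is the image of the corresponding entry. [cite: Moore1966, Ch. 3 (interval arithmetic: inclusion property)] -/
theorem omap_spec {α β : Type} [Inhabited α] [Inhabited β] {f : α → Option β} :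
    ∀ {xs : List α} {ys : List β}, omap f xs = some ys →
      ys.length = xs.length ∧ ∀ i < xs.length, f (xs.getD i default) = some (ys.getD i default)
  | [], ys, h => by
      simp only [omap, Option.some.injEq] at h
      subst h; simp
  | x :: xs, ys, h => by
      simp only [omap] at h
      split at h
      · rename_i y ys' hy hys
        simp only [Option.some.injEq] at h
        subst h
        obtain ⟨hl, hi⟩ := omap_spec hys
        refine ⟨by simp [hl], fun i hi' ↦ ?_⟩
        cases i with
        | zero => simpa using hy
        | succ i =>
          simp only [List.getD_cons_succ]
          exact hi i (by simpa using hi')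
      · simp at h

/-! ## 5. Records: parameters, constants, per-index special values -/

/-- Numerical parameters of the evaluator. [cite: Moore1966, Ch. 3 (interval arithmetic: inclusion property)] -/
structure Params where
  /-- binary scale of all intervals -/
  S : ℕ
  /-- number of series terms for `exp`, `log`, `arctan`, `e^{iθ}` -/
  Kser : ℕ
  /-- number of argument halvings for `exp` / `e^{iθ}` -/
  kred : ℕ
  /-- number of terms kept in the exponential sums (`≥ 1`) -/
  Kexp : ℕ
  /-- shift of the Stirling series for `ψ`, `ψ′` -/
  J : ℕ
  deriving Repr, Inhabited

/-- The index-independent constants of the window `[−a, a]` (enclosures at scale `S`). [cite: Moore1966, Ch. 3 (interval arithmetic: inclusion property)] -/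
structure Consts where
  /-- `π` -/
  P : MI
  /-- `a` -/
  A : MI
  /-- `1/a` -/
  invA : MI
  /-- `1/π` -/
  invPi : MI
  /-- `log π` -/
  logPi : MI
  /-- `(4/a)(e^{a/2} − e^{−a/2})²` -/
  polC : MI
  /-- `e_k = e^{−2a l_k}`, `k < Kexp` -/
  eks : List MI
  /-- scaled majorant of the tail `Σ_{k ≥ Kexp} e_k` -/
  tailE : ℤ
  /-- the lengths `ℓ_q = e log p` -/
  lens : List MI
  /-- the weights `Λ(q) q^{−1/2}` -/
  wts : List MI
  /-- the diagonal prime factors `2 − ℓ_q/a` -/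
  ws : List MI
  deriving Repr, Inhabited

/-- The special values at the mode `n` (enclosures at scale `S`). [cite: Moore1966, Ch. 3 (interval arithmetic: inclusion property)] -/
structure IdxRec where
  /-- `ω_n = πn/a` -/
  om : MI
  /-- `1/(1 + 4ω_n²)` -/
  c : MI
  /-- `Im ψ(¼ + iω_n/2)` -/
  imP : MI
  /-- `archExpSumSin a n` -/
  eS : MI
  /-- `e^{iω_n ℓ_q}` for the listed prime powers -/
  cs : List MC
  /-- `Re ψ(¼ + iω_n/2)` -/
  reP : MI
  /-- `Re ψ′(¼ + iω_n/2)` -/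
  rePD : MI
  /-- `archExpSumDiag a n` -/
  eD : MI
  deriving Repr, Inhabited, DecidableEq

/-- Validity of the list of `e_k`. [cite: Moore1966, Ch. 3 (interval arithmetic: inclusion property)] -/
def EksValid (S : ℕ) (a : ℝ) (es : List MI) : Prop :=
  ∀ k < es.length, MI.mem S (Real.exp (-(2 * a * digammaNode k))) (es.getD k default)

/-- Validity of the constants record. [cite: Moore1966, Ch. 3 (interval arithmetic: inclusion property)] -/
structure ConstsValid (S : ℕ) (a : ℝ) (ks : List PrimeLen) (C : Consts) : Prop where
  /-- `π ∈ P` -/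
  pi : MI.mem S Real.pi C.P
  /-- `a ∈ A` -/
  ha : MI.mem S a C.A
  /-- `1/a ∈ invA` -/
  invA : MI.mem S (1 / a) C.invA
  /-- `1/π ∈ invPi` -/
  invPi : MI.mem S (1 / Real.pi) C.invPi
  /-- `log π ∈ logPi` -/
  logPi : MI.mem S (Real.log Real.pi) C.logPi
  /-- the polar constant -/
  polC : MI.mem S (4 / a * (Real.exp (a / 2) - Real.exp (-(a / 2))) ^ 2) C.polC
  /-- the exponential table -/
  eks : EksValid S a C.eks
  /-- at least one term is kept -/
  eks_pos : 1 ≤ C.eks.length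
  /-- the tail majorant -/
  tail : Real.exp (-(a * (4 * C.eks.length + 1))) / (1 - Real.exp (-(4 * a))) * S ≤ C.tailE
  /-- list lengths -/
  lens_len : C.lens.length = ks.length
  /-- list lengths -/
  wts_len : C.wts.length = ks.length
  /-- list lengths -/
  ws_len : C.ws.length = ks.length
  /-- `ℓ_q ∈ lens` -/
  lens : ∀ i < ks.length, MI.mem S (ks.getD i default).len (C.lens.getD i default)
  /-- `Λ(q)q^{-1/2} ∈ wts` -/
  wts : ∀ i < ks.length, MI.mem S (ks.getD i default).wt (C.wts.getD i default)
  /-- `2 − ℓ_q/a ∈ ws` -/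
  ws : ∀ i < ks.length, MI.mem S (2 - (ks.getD i default).len / a) (C.ws.getD i default)

/-- Validity of the OFF-DIAGONAL fields of an index record at an integer mode `m`. [cite: Moore1966, Ch. 3 (interval arithmetic: inclusion property)] -/
structure OffValid (S : ℕ) (a : ℝ) (ks : List PrimeLen) (m : ℤ) (R : IdxRec) : Prop where
  /-- `ω_m ∈ om` -/
  om : MI.mem S (freq a m) R.om
  /-- `1/(1+4ω_m²) ∈ c` -/
  c : MI.mem S (1 / (1 + 4 * freq a m ^ 2)) R.c
  /-- `Im ψ(¼ + iω_m/2) ∈ imP` -/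
  imP : MI.mem S (Complex.digamma (1 / 4 + ((freq a m : ℝ) : ℂ) / 2 * I)).im R.imP
  /-- `archExpSumSin a m ∈ eS` -/
  eS : MI.mem S (archExpSumSin a m) R.eS
  /-- list lengths -/
  cs_len : R.cs.length = ks.length
  /-- `e^{iω_m ℓ_q} ∈ cs` -/
  cs : ∀ i < ks.length, MC.mem S (Complex.exp ((((freq a m * (ks.getD i default).len : ℝ)) : ℂ) * I)) (R.cs.getD i default)

/-- Validity of the DIAGONAL fields of an index record at a mode `n`. [cite: Moore1966, Ch. 3 (interval arithmetic: inclusion property)] -/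
structure DiagValid (S : ℕ) (a : ℝ) (n : ℤ) (R : IdxRec) : Prop where
  /-- `Re ψ(¼ + iω_n/2) ∈ reP` -/
  reP : MI.mem S (reDigammaQuarter (freq a n)) R.reP
  /-- `Re ψ′(¼ + iω_n/2) ∈ rePD` -/
  rePD : MI.mem S (deriv Complex.digamma (1 / 4 + ((freq a n : ℝ) : ℂ) / 2 * I)).re R.rePD
  /-- `archExpSumDiag a n ∈ eD` -/
  eD : MI.mem S (archExpSumDiag a n) R.eD

/-- Validity of an index record at a natural mode `n`: off-diagonal and diagonal fields. [cite: Moore1966, Ch. 3 (interval arithmetic: inclusion property)] -/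
def IdxValid (S : ℕ) (a : ℝ) (ks : List PrimeLen) (n : ℕ) (R : IdxRec) : Prop :=
  OffValid S a ks n R ∧ DiagValid S a n R

/-- The record of the mode `−m`: flip the signs of the odd fields, conjugate the phases. [cite: Moore1966, Ch. 3 (interval arithmetic: inclusion property)] -/
def IdxRec.flip (R : IdxRec) : IdxRec :=
  { R with om := R.om.neg, imP := R.imP.neg, eS := R.eS.neg, cs := R.cs.map MC.conj }

/-- **Parity**: a record valid at `m` flips to a record valid at `−m`. [cite: Moore1966, Ch. 3 (interval arithmetic: inclusion property)] -/
theorem OffValid.flip {S : ℕ} {ks : List PrimeLen} {m : ℤ} {R : IdxRec} (h : OffValid S a ks m R) :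
    OffValid S a ks (-m) R.flip where
  om := by rw [freq_neg]; exact MI.mem_neg h.om
  c := by rw [freq_neg, neg_sq]; exact h.c
  imP := by
    rw [freq_neg, im_digamma_quarter_neg]
    exact MI.mem_neg h.imP
  eS := by rw [archExpSumSin_neg]; exact MI.mem_neg h.eS
  cs_len := by simp [IdxRec.flip, h.cs_len]
  cs := fun i hi ↦ by
    have e : R.flip.cs.getD i default = MC.conj (R.cs.getD i default) := by
      simp only [IdxRec.flip, List.getD_eq_getElem?_getD, List.getElem?_map]
      rw [← h.cs_len] at hi
      simp [List.getElem?_eq_getElem hi]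
    rw [e, freq_neg, neg_mul, cexp_neg_mul_I]
    exact MC.mem_conj (h.cs i hi)

/-! ## 6. Computing the constants -/


variable {S : ℕ}

/-- Transport of membership along an equality of the real number. [cite: Moore1966, Ch. 3 (interval arithmetic: inclusion property)] -/
theorem mem_of_eq {x y : ℝ} {I : MI} (h : MI.mem S x I) (e : x = y) : MI.mem S y I := e ▸ h

/-- `[e_0, …, e_{K−1}]`, `e_k = e^{−a(4k+1)} = e^{−2a l_k}`. [cite: Moore1966, Ch. 3 (interval arithmetic: inclusion property)] -/
def expList (prm : Params) (A : MI) : Option (List MI) :=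
  omap (fun k : ℕ ↦ MI.exp prm.S prm.Kser prm.kred (A.mulInt (-(4 * (k : ℤ) + 1)))) (List.range prm.Kexp)

/-- Scaled majorant of the geometric tail `e^{−a(4K+1)}/(1 − e^{−4a})`, `K = Kexp`. [cite: Moore1966, Ch. 3 (interval arithmetic: inclusion property)] -/
def tailBound (prm : Params) (A : MI) : Option ℤ :=
  match MI.exp prm.S prm.Kser prm.kred (A.mulInt (-(4 * (prm.Kexp : ℤ) + 1))),
        MI.exp prm.S prm.Kser prm.kred (A.mulInt (-4)) with
  | some EK, some E4 =>
    match MI.divPos prm.S EK ((MI.ofInt prm.S 1).sub E4) with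
    | some T => some T.hi
    | none => none
  | _, _ => none

/-- The polar constant `(4/a)(e^{a/2} − e^{−a/2})²`. [cite: Yoshida1992HermitianForms, §5 (5.1) p. 297] -/
def polConst (prm : Params) (A : MI) : Option MI :=
  match MI.exp prm.S prm.Kser prm.kred (A.divNat 2), MI.exp prm.S prm.Kser prm.kred ((A.divNat 2).neg) with
  | some Ep, some Em => MI.divPos prm.S (((Ep.sub Em).sqr prm.S).mulInt 4) A
  | _, _ => none

/-- `ℓ_q = e log p`. [cite: Moore1966, Ch. 3 (interval arithmetic: inclusion property)] -/
def lenBox (prm : Params) (q : PrimeLen) : Option MI :=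
  match MI.logNat2 prm.S prm.Kser q.p with
  | some L => some (L.mulInt q.e)
  | none => none

/-- `Λ(q)q^{−1/2} = log p · e^{−ℓ_q/2}`. [cite: Moore1966, Ch. 3 (interval arithmetic: inclusion property)] -/
def wtBox (prm : Params) (q : PrimeLen) : Option MI :=
  match MI.logNat2 prm.S prm.Kser q.p, lenBox prm q with
  | some Lp, some L =>
    match MI.exp prm.S prm.Kser prm.kred ((L.divNat 2).neg) with
    | some E => some (Lp.mul prm.S E)
    | none => none
  | _, _ => none

/-- `2 − ℓ_q/a`. [cite: Moore1966, Ch. 3 (interval arithmetic: inclusion property)] -/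
def wBox (prm : Params) (invA : MI) (q : PrimeLen) : Option MI :=
  match lenBox prm q with
  | some L => some ((MI.ofInt prm.S 2).sub (L.mul prm.S invA))
  | none => none

/-- **The constants of the window** from enclosures `P ∋ π`, `A ∋ a` and the prime data `ks`. [cite: Moore1966, Ch. 3 (interval arithmetic: inclusion property)] -/
def consts (prm : Params) (P A : MI) (ks : List PrimeLen) : Option Consts :=
  match MI.divPos prm.S (MI.ofInt prm.S 1) A, MI.divPos prm.S (MI.ofInt prm.S 1) P, MI.logPos prm.S prm.Kser P with
  | some iA, some iP, some lP =>
    match polConst prm A, expList prm A, tailBound prm A with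
    | some pC, some es, some t =>
      match omap (lenBox prm) ks, omap (wtBox prm) ks, omap (wBox prm iA) ks with
      | some ls, some wt, some w => some ⟨P, A, iA, iP, lP, pC, es, t, ls, wt, w⟩
      | _, _, _ => none
    | _, _, _ => none
  | _, _, _ => none

variable {prm : Params} {a : ℝ}

/-- `lenBox ∋ ℓ_q`. [cite: Moore1966, Ch. 3 (interval arithmetic: inclusion property)] -/
theorem mem_lenBox (hS : 0 < prm.S) {q : PrimeLen} {L : MI} (h : lenBox prm q = some L) : MI.mem prm.S q.len L := by
  unfold lenBox at h
  split at h
  · rename_i L' hL'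
    simp only [Option.some.injEq] at h
    subst h
    have := MI.mem_mulInt (MI.mem_logNat2 hS hL') (q.e : ℤ)
    refine mem_of_eq this ?_
    unfold PrimeLen.len; push_cast; ring
  · simp at h

/-- `wtBox ∋ Λ(q)q^{−1/2}`. [cite: Moore1966, Ch. 3 (interval arithmetic: inclusion property)] -/
theorem mem_wtBox (hS : 0 < prm.S) {q : PrimeLen} {Y : MI} (h : wtBox prm q = some Y) : MI.mem prm.S q.wt Y := by
  unfold wtBox at h
  split at h
  · rename_i Lp L hLp hL
    split at h
    · rename_i E hE
      simp only [Option.some.injEq] at h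
      subst h
      have hlen := mem_lenBox hS hL
      have hE' := MI.mem_exp hS hE (MI.mem_neg (MI.mem_divNat hlen (n := 2) (by norm_num)))
      have := MI.mem_mul hS (MI.mem_logNat2 hS hLp) hE'
      refine mem_of_eq this ?_
      unfold PrimeLen.wt; push_cast; ring_nf
    · simp at h
  · simp at h

/-- `wBox ∋ 2 − ℓ_q/a`. [cite: Moore1966, Ch. 3 (interval arithmetic: inclusion property)] -/
theorem mem_wBox (hS : 0 < prm.S) {invA : MI} (hiA : MI.mem prm.S (1 / a) invA) {q : PrimeLen} {Y : MI}
    (h : wBox prm invA q = some Y) : MI.mem prm.S (2 - q.len / a) Y := by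
  unfold wBox at h
  split at h
  · rename_i L hL
    simp only [Option.some.injEq] at h
    subst h
    have := MI.mem_sub (MI.mem_ofInt prm.S 2) (MI.mem_mul hS (mem_lenBox hS hL) hiA)
    refine mem_of_eq this ?_
    push_cast; ring
  · simp at h

/-- `polConst ∋ (4/a)(e^{a/2} − e^{−a/2})²`. [cite: Moore1966, Ch. 3 (interval arithmetic: inclusion property)] -/
theorem mem_polConst (hS : 0 < prm.S) {A Y : MI} (ha : MI.mem prm.S a A) (h : polConst prm A = some Y) :
    MI.mem prm.S (4 / a * (Real.exp (a / 2) - Real.exp (-(a / 2))) ^ 2) Y := by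
  unfold polConst at h
  split at h
  · rename_i Ep Em hEp hEm
    have h2 := MI.mem_divNat ha (n := 2) (by norm_num)
    have hd := MI.mem_sub (MI.mem_exp hS hEp h2) (MI.mem_exp hS hEm (MI.mem_neg h2))
    have := MI.mem_divPos hS h (MI.mem_mulInt (MI.mem_sqr hS hd) 4) ha
    refine mem_of_eq this ?_
    push_cast; ring
  · simp at h

/-- `expList` is a valid exponential table of length `Kexp`. [cite: Moore1966, Ch. 3 (interval arithmetic: inclusion property)] -/
theorem eksValid_of_expList (hS : 0 < prm.S) {A : MI} (ha : MI.mem prm.S a A) {es : List MI}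
    (h : expList prm A = some es) : es.length = prm.Kexp ∧ EksValid prm.S a es := by
  obtain ⟨hl, hi⟩ := omap_spec h
  rw [List.length_range] at hl hi
  refine ⟨hl, fun k hk ↦ ?_⟩
  rw [hl] at hk
  have h1 := hi k hk
  rw [List.getD_eq_getElem?_getD, List.getElem?_range hk, Option.getD_some] at h1
  have := MI.mem_exp hS h1 (MI.mem_mulInt ha _)
  refine mem_of_eq this ?_
  unfold digammaNode; push_cast; ring_nf

/-- `tailBound` majorises the scaled geometric tail. [cite: Moore1966, Ch. 3 (interval arithmetic: inclusion property)] -/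
theorem tail_le_of_tailBound (hS : 0 < prm.S) {A : MI} (ha : MI.mem prm.S a A) {t : ℤ}
    (h : tailBound prm A = some t) :
    Real.exp (-(a * (4 * prm.Kexp + 1))) / (1 - Real.exp (-(4 * a))) * prm.S ≤ t := by
  unfold tailBound at h
  split at h
  · rename_i EK E4 hEK hE4
    split at h
    · rename_i T hT
      simp only [Option.some.injEq] at h
      subst h
      have h1 : MI.mem prm.S (Real.exp (-(a * (4 * prm.Kexp + 1)))) EK := by
        refine mem_of_eq (MI.mem_exp hS hEK (MI.mem_mulInt ha _)) ?_
        push_cast; ring_nf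
      have h2 : MI.mem prm.S (1 - Real.exp (-(4 * a))) ((MI.ofInt prm.S 1).sub E4) := by
        refine mem_of_eq (MI.mem_sub (MI.mem_ofInt prm.S 1) (MI.mem_exp hS hE4 (MI.mem_mulInt ha _))) ?_
        push_cast; ring_nf
      exact (MI.mem_divPos hS hT h1 h2).2
    · simp at h
  · simp at h

/-- **`consts` is valid**: every field encloses the constant it names. [cite: Moore1966, Ch. 3 (interval arithmetic: inclusion property)] -/
theorem constsValid_of_consts (hS : 0 < prm.S) (hK : 1 ≤ prm.Kexp) {P A : MI} (hpi : MI.mem prm.S Real.pi P)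
    (ha : MI.mem prm.S a A) {ks : List PrimeLen} {C : Consts} (h : consts prm P A ks = some C) :
    ConstsValid prm.S a ks C := by
  unfold consts at h
  split at h
  · rename_i iA iP lP hiA hiP hlP
    split at h
    · rename_i pC es t hpC hes ht
      split at h
      · rename_i ls wt w hls hwt hw
        simp only [Option.some.injEq] at h
        subst h
        have hiA' : MI.mem prm.S (1 / a) iA :=
          mem_of_eq (MI.mem_divPos hS hiA (MI.mem_ofInt prm.S 1) ha) (by push_cast; ring)
        obtain ⟨hesl, hesv⟩ := eksValid_of_expList hS ha hes
        obtain ⟨hlsl, hlsi⟩ := omap_spec hls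
        obtain ⟨hwtl, hwti⟩ := omap_spec hwt
        obtain ⟨hwl, hwi⟩ := omap_spec hw
        exact
          { pi := hpi
            ha := ha
            invA := hiA'
            invPi := mem_of_eq (MI.mem_divPos hS hiP (MI.mem_ofInt prm.S 1) hpi) (by push_cast; ring)
            logPi := (MI.mem_logPos hS hlP hpi).2
            polC := mem_polConst hS ha hpC
            eks := hesv
            eks_pos := by simpa [hesl] using hK
            tail := by simpa [hesl] using tail_le_of_tailBound hS ha ht
            lens_len := hlsl
            wts_len := hwtl
            ws_len := hwl
            lens := fun i hi ↦ mem_lenBox hS (hlsi i hi)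
            wts := fun i hi ↦ mem_wtBox hS (hwti i hi)
            ws := fun i hi ↦ mem_wBox hS hiA' (hwi i hi) }
      · simp at h
    · simp at h
  · simp at h


/-! ## 7. Computing the special values at a mode -/

/-- `L_k = l_k² = (4k+1)²/4` as an interval. [cite: Moore1966, Ch. 3 (interval arithmetic: inclusion property)] -/
def nodeSq (S : ℕ) (k : ℕ) : MI := MI.ofFrac S ((4 * (k : ℤ) + 1) ^ 2) 4

/-- `nodeSq ∋ l_k²`. [cite: Moore1966, Ch. 3 (interval arithmetic: inclusion property)] -/
theorem mem_nodeSq (S : ℕ) (k : ℕ) : MI.mem S (digammaNode k ^ 2) (nodeSq S k) := by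
  refine mem_of_eq (MI.mem_ofFrac S ((4 * (k : ℤ) + 1) ^ 2) (q := 4) (by norm_num)) ?_
  unfold digammaNode; push_cast; ring

/-- `Σ_i e_{k+i}(l_{k+i}² − ω²)/(l_{k+i}² + ω²)²` over the table entries. [cite: Yoshida1992HermitianForms, §5 (5.15) p. 301] -/
def dsum (S : ℕ) (om2 : MI) : ℕ → List MI → Option MI
  | _, [] => some (MI.ofInt S 0)
  | k, e :: es =>
    match MI.divPos S ((nodeSq S k).sub om2) (((nodeSq S k).add om2).sqr S), dsum S om2 (k + 1) es with
    | some q, some r => some ((e.mul S q).add r)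
    | _, _ => none

/-- `Σ_i e_{k+i} ω/(l_{k+i}² + ω²)` over the table entries. [cite: Yoshida1992HermitianForms, §5 (5.16) p. 301] -/
def ssum (S : ℕ) (om om2 : MI) : ℕ → List MI → Option MI
  | _, [] => some (MI.ofInt S 0)
  | k, e :: es =>
    match MI.divPos S om ((nodeSq S k).add om2), ssum S om om2 (k + 1) es with
    | some q, some r => some ((e.mul S q).add r)
    | _, _ => none

/-- **`dsum` encloses the truncated diagonal exponential sum.** [cite: Moore1966, Ch. 3 (interval arithmetic: inclusion property)] -/
theorem mem_dsum (hS : 0 < S) {ω : ℝ} {om2 : MI} (hom2 : MI.mem S (ω ^ 2) om2) :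
    ∀ (es : List MI) (k : ℕ) {Y : MI},
      (∀ i < es.length, MI.mem S (Real.exp (-(2 * a * digammaNode (k + i)))) (es.getD i default)) →
      dsum S om2 k es = some Y →
      MI.mem S (∑ i ∈ Finset.range es.length, Real.exp (-(2 * a * digammaNode (k + i))) *
        ((digammaNode (k + i) ^ 2 - ω ^ 2) / (digammaNode (k + i) ^ 2 + ω ^ 2) ^ 2)) Y
  | [], k, Y, _, h => by
      simp only [dsum, Option.some.injEq] at h
      subst h; simpa using MI.mem_ofInt S 0
  | e :: es, k, Y, hes, h => by
      simp only [dsum] at h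
      split at h
      · rename_i q r hq hr
        simp only [Option.some.injEq] at h
        subst h
        rw [List.length_cons, Finset.sum_range_succ']
        simp only [add_zero]
        have h0 : MI.mem S (Real.exp (-(2 * a * digammaNode k))) e := by simpa using hes 0 (by simp)
        have hq' := MI.mem_divPos hS hq (MI.mem_sub (mem_nodeSq S k) hom2)
          (MI.mem_sqr hS (MI.mem_add (mem_nodeSq S k) hom2))
        have ih := mem_dsum hS hom2 es (k + 1) (fun i hi ↦ by
          have := hes (i + 1) (by simpa using hi)
          simpa [List.getD_cons_succ, Nat.add_assoc, Nat.add_comm 1 i] using this) hr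
        rw [Finset.sum_congr rfl fun i _ ↦ by rw [show k + (i + 1) = k + 1 + i by omega], add_comm]
        exact MI.mem_add (MI.mem_mul hS h0 hq') ih
      · simp at h

/-- **`ssum` encloses the truncated off-diagonal exponential sum.** [cite: Moore1966, Ch. 3 (interval arithmetic: inclusion property)] -/
theorem mem_ssum (hS : 0 < S) {ω : ℝ} {om om2 : MI} (hom : MI.mem S ω om) (hom2 : MI.mem S (ω ^ 2) om2) :
    ∀ (es : List MI) (k : ℕ) {Y : MI},
      (∀ i < es.length, MI.mem S (Real.exp (-(2 * a * digammaNode (k + i)))) (es.getD i default)) →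
      ssum S om om2 k es = some Y →
      MI.mem S (∑ i ∈ Finset.range es.length, Real.exp (-(2 * a * digammaNode (k + i))) *
        (ω / (digammaNode (k + i) ^ 2 + ω ^ 2))) Y
  | [], k, Y, _, h => by
      simp only [ssum, Option.some.injEq] at h
      subst h; simpa using MI.mem_ofInt S 0
  | e :: es, k, Y, hes, h => by
      simp only [ssum] at h
      split at h
      · rename_i q r hq hr
        simp only [Option.some.injEq] at h
        subst h
        rw [List.length_cons, Finset.sum_range_succ']
        simp only [add_zero]
        have h0 : MI.mem S (Real.exp (-(2 * a * digammaNode k))) e := by simpa using hes 0 (by simp)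
        have hq' := MI.mem_divPos hS hq hom (MI.mem_add (mem_nodeSq S k) hom2)
        have ih := mem_ssum hS hom hom2 es (k + 1) (fun i hi ↦ by
          have := hes (i + 1) (by simpa using hi)
          simpa [List.getD_cons_succ, Nat.add_assoc, Nat.add_comm 1 i] using this) hr
        rw [Finset.sum_congr rfl fun i _ ↦ by rw [show k + (i + 1) = k + 1 + i by omega], add_comm]
        exact MI.mem_add (MI.mem_mul hS h0 hq') ih
      · simp at h

/-- The box `¼ + i·om/2`. [cite: Moore1966, Ch. 3 (interval arithmetic: inclusion property)] -/
def quarterBox (S : ℕ) (om : MI) : MC := ⟨MI.ofFrac S 1 4, om.divNat 2⟩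

/-- `quarterBox ∋ ¼ + iω/2`. [cite: Moore1966, Ch. 3 (interval arithmetic: inclusion property)] -/
theorem mem_quarterBox {ω : ℝ} {om : MI} (hom : MI.mem S ω om) :
    MC.mem S (1 / 4 + (ω : ℂ) / 2 * I) (quarterBox S om) := by
  have hre : (1 / 4 + (ω : ℂ) / 2 * I).re = ((1 : ℤ) : ℝ) / ((4 : ℕ) : ℝ) := by simp
  have him : (1 / 4 + (ω : ℂ) / 2 * I).im = ω / ((2 : ℕ) : ℝ) := by simp
  refine ⟨?_, ?_⟩
  · rw [hre]; exact MI.mem_ofFrac S 1 (q := 4) (by norm_num)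
  · rw [him]; exact MI.mem_divNat hom (by norm_num)

/-- **The special values at the mode `n`** (kernel function). [cite: Yoshida1992HermitianForms, §5 (5.15)-(5.16) p. 301] -/
def idxRec (prm : Params) (C : Consts) (n : ℕ) : Option IdxRec :=
  match MI.divPos prm.S (C.P.mulInt n) C.A with
  | none => none
  | some om =>
    match MI.divPos prm.S (MI.ofInt prm.S 1) ((MI.ofInt prm.S 1).add ((om.sqr prm.S).mulInt 4)),
          MC.digammaBox prm.S prm.Kser prm.J C.P MC.bernoulliTable (quarterBox prm.S om),
          MC.trigammaBox prm.S prm.J MC.bernoulliTable (quarterBox prm.S om) with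
    | some c, some Ψ, some Ψ' =>
      match dsum prm.S (om.sqr prm.S) 0 C.eks, ssum prm.S om (om.sqr prm.S) 0 C.eks,
            omap (fun L ↦ MC.expI prm.S prm.Kser prm.kred C.P (om.mul prm.S L)) C.lens with
      | some eD, some eS, some cs =>
          some ⟨om, c, Ψ.im, eS.widen C.tailE, cs, Ψ.re, Ψ'.re, eD.widen C.tailE⟩
      | _, _, _ => none
    | _, _, _ => none

/-- The proved Bernoulli table has the coefficients `B_{2(k+1)}`. [cite: AbramowitzStegun1964, Table 23.2] -/
theorem bernoulliTable_spec : ∀ k < MC.bernoulliTable.length,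
    ((MC.bernoulliTable.getD k 0 : ℚ) : ℂ) = (bernoulli (2 * (k + 1)) : ℂ) := fun k hk ↦ by
  have hk' : k < 10 := by simpa [MC.bernoulliTable] using hk
  exact_mod_cast MC.bernoulliTable_getD hk'

/-- **`idxRec` is valid**: every field encloses the special value it names. [cite: Moore1966, Ch. 3 (interval arithmetic: inclusion property)] -/
theorem idxValid_of_idxRec (hS : 0 < prm.S) (ha0 : 0 < a) {ks : List PrimeLen} {C : Consts}
    (hC : ConstsValid prm.S a ks C) {n : ℕ} {R : IdxRec} (h : idxRec prm C n = some R) :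
    IdxValid prm.S a ks n R := by
  unfold idxRec at h
  split at h
  · simp at h
  · rename_i om hom
    split at h
    · rename_i c Ψ Ψ' hc hΨ hΨ'
      split at h
      · rename_i eD eS cs heD heS hcs
        simp only [Option.some.injEq] at h
        subst h
        -- the frequency
        have hω : MI.mem prm.S (freq a n) om := by
          refine mem_of_eq (MI.mem_divPos hS hom (MI.mem_mulInt hC.pi n) hC.ha) ?_
          unfold freq; push_cast; ring
        have hω2 : MI.mem prm.S (freq a n ^ 2) (om.sqr prm.S) := MI.mem_sqr hS hω
        have hW := mem_quarterBox (S := prm.S) hω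
        have hψ := MC.mem_digammaBox_table hS hC.pi hΨ hW
        have hψ' := MC.mem_trigammaBox hS (by simp [MC.bernoulliTable]) bernoulliTable_spec hΨ' hW
        have hK : 1 ≤ C.eks.length := hC.eks_pos
        -- truncated exponential sums
        have heD' := mem_dsum (a := a) hS hω2 C.eks 0 (fun i hi ↦ by simpa using hC.eks i hi) heD
        have heS' := mem_ssum (a := a) hS hω hω2 C.eks 0 (fun i hi ↦ by simpa using hC.eks i hi) heS
        simp only [Nat.zero_add] at heD' heS'
        have htailD : |archExpSumDiag a n - ∑ i ∈ Finset.range C.eks.length, diagTerm a n i| * prm.S ≤ C.tailE :=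
          le_trans (mul_le_mul_of_nonneg_right (abs_archExpSumDiag_sub_sum_le ha0 n hK) (Nat.cast_nonneg _)) hC.tail
        have htailS : |archExpSumSin a n - ∑ i ∈ Finset.range C.eks.length, sinTerm a n i| * prm.S ≤ C.tailE :=
          le_trans (mul_le_mul_of_nonneg_right (abs_archExpSumSin_sub_sum_le ha0 n _) (Nat.cast_nonneg _)) hC.tail
        obtain ⟨hcsl, hcsi⟩ := omap_spec hcs
        refine ⟨{ om := hω, c := ?_, imP := hψ.2, eS := ?_, cs_len := by rw [hcsl, hC.lens_len], cs := ?_ },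
          { reP := hψ.1, rePD := hψ'.1, eD := ?_ }⟩
        · refine mem_of_eq (MI.mem_divPos hS hc (MI.mem_ofInt prm.S 1)
            (MI.mem_add (MI.mem_ofInt prm.S 1) (MI.mem_mulInt hω2 4))) ?_
          push_cast; ring
        · exact MI.mem_widen heS' htailS
        · intro i hi
          rw [← hC.lens_len] at hi
          exact MC.mem_expI hS hC.pi (hcsi i hi) (MI.mem_mul hS hω (hC.lens i (hC.lens_len ▸ hi)))
        · exact MI.mem_widen heD' htailD
      · simp at h
    · simp at h

end Encl

end Literature.NumberTheory.LFunctions.Yoshida1992
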